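import Summits.ABC.IUTFork.Cor312UnitCosetCoarseCells
import Summits.ABC.IUTFork.Repair.EvalHonestCeiling
import HarnessLib

/-!
# IUT REPAIR — cross-checker: the CONTAINER CEILING for the log-shell rows RP-I06 / RP-I06⋆ / RP-I05c (cx MODEL-SPACE LIMIT #5 made a theorem; abc-iut-rp-cx gen 2)

Seat abc-iut-rp-cx (gen 2), rung LADDER-ABC:A2.RP; PROOF-ONLY (no `def`). EVAL-SUMMARY v1.0 listed as MODEL-SPACE LIMIT #5 «no SAT+ witness
for RP-I05c (the (Ind3)-container bound `CandInternal11.H`)»; gen-0's ceiling `EvalHonestCeiling.i06_false_of_honest` covers only beds with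
RP-I05b `HInd3Theta` (log-shell container INSIDE the Kummer image), which abc-iut-w4-d101's coarse-coset bed K does not satisfy (its container is
the BALL `q^{j²}𝒪`, its Kummer image the PAIR `±q^{j²}(1+p𝒪)`), although RP-I05c fails there too (`Cor312UnitCosetCoarseCells.i05c_not_at_kSetting`).
THIS FILE states the ceiling that covers both and NAMES THE ESCAPE:
* `hQShellOrbit_false_of_container` (§1): on a q-pinned setting with monotone log-volume, if at ONE scaled label `j = i+1 ≥ 2` every region
  `ρ(frobΨ m · 𝓘)` lies in one admissible CONTAINER `C` of log-volume `≤ j²·(local q-volume)` and the local q-volume is negative, then RP-I06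
  `HQShellOrbit` is false; hence (`i05c_false_of_container`) RP-I05c is false as soon as the hull clause `PilotKummerCompatHull` holds
  (rp-d2's `CandInternal11.hQShellOrbit_of_hull`), and (`hQShellOrbitStar_false_of_container`) so is RP-I06⋆.
* §2: at K the container is `C = q^{j²}𝒪` (`cosetRegion_shellSat_subset`), admissible, of volume `−j²·log p = j²·qLocal` — the ceiling
  re-derives w4-d101's three cells `¬I06`, `¬I06⋆`, `¬I05c` (`i06_false_k`, `i06star_false_k'`, `i05c_false_k'`) from ONE hypothesis shape.
CONSEQUENCE FOR LIMIT #5 (neutral, a statement about the typed model space): a SAT+ witness for RP-I05c / RP-I06 must have, at the binding label,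
a log-shell container of log-volume STRICTLY GREATER than `j²·(q-volume)` — log-shell inflation at least as large as the frame's (abc-iut-rp-d2's
FAT beds have it but lose the Statement; K has the Statement but a tight container). No side taken on [IUTchIII] Cor. 3.12 or on any author;
candidates are hypotheses; model data ≠ intended objects; typed ≠ proved.
-/

noncomputable section

namespace Summit.ABC.IUTFork.Repair.EvalContainerCeiling

open Set Thm311 Cor312 Cor312Vol Literature.IUT.LogThetaLattice Summit.ABC.IUTFork.Repair.CandInternal2
  Summit.ABC.IUTFork.Repair.EvalHonestCeiling

/-! ## 1. The container ceiling (general) -/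

section General

variable {T : ThetaIndex} (S : LatticeSituation T) (P : Cor312.Setting S.toSituation)
  (ρ : (∀ v : T.V, v ∈ T.Vbad → Set (S.L.StarPacket v)) → ∀ (j : T.Label) (vQ : T.VQ), Set (S.L.Packet j vQ))
  (qK : ∀ v : T.V, v ∈ T.Vbad → Set (S.L.StarPacket v))

/-- **RP-I06 `HQShellOrbit` is false under a tight container.** [folklore] -/
theorem hQShellOrbit_false_of_container (hq : QPinned S P ρ qK) (hmono : LogvolMono P)
    (i : Fin T.lstar) (hi : 1 ≤ (i : ℕ)) (vQ : T.VQ) (C : Set (S.L.Packet (Setting.labelSucc i) vQ))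
    (hC : ∀ m : ℤ, ρ (shellSat S P.n ((S.col P.n).frobΨ m)) (Setting.labelSucc i) vQ ⊆ C)
    (hCadm : (S.D P.n).Adm _ vQ C)
    (hCvol : (S.D P.n).logvol _ vQ C ≤ (((i : ℕ) + 1 : ℕ) : ℝ) ^ 2 * P.qLocal (Setting.labelSucc i) vQ)
    (hneg : P.qLocal (Setting.labelSucc i) vQ < 0) :
    ¬ HQShellOrbit S P ρ qK := fun hB => by
  have hsub : P.qRegion (Setting.labelSucc i) vQ ⊆ C := fun x hx => by
    rw [hq] at hx
    obtain ⟨m, hm⟩ := Set.mem_iUnion.1 (hB _ vQ hx)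
    exact hC m hm
  have h1 := hmono i vQ (P.hul_adm _ vQ _ (P.qRegion_mem _ vQ)) hCadm hsub
  exact not_le_jsq_mul_of_neg hneg hi (h1.trans hCvol)

/-- **RP-I05c (`CandInternal11.H`, the (Ind3)-container bound) is false under a tight container and the hull clause.** [folklore] -/
theorem i05c_false_of_container (hq : QPinned S P ρ qK) (hmono : LogvolMono P)
    (i : Fin T.lstar) (hi : 1 ≤ (i : ℕ)) (vQ : T.VQ) (C : Set (S.L.Packet (Setting.labelSucc i) vQ))
    (hC : ∀ m : ℤ, ρ (shellSat S P.n ((S.col P.n).frobΨ m)) (Setting.labelSucc i) vQ ⊆ C)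
    (hCadm : (S.D P.n).Adm _ vQ C)
    (hCvol : (S.D P.n).logvol _ vQ C ≤ (((i : ℕ) + 1 : ℕ) : ℝ) ^ 2 * P.qLocal (Setting.labelSucc i) vQ)
    (hneg : P.qLocal (Setting.labelSucc i) vQ < 0) (hh : PilotKummerCompatHull S P ρ qK) :
    ¬ CandInternal11.H S P ρ := fun hc =>
  hQShellOrbit_false_of_container S P ρ qK hq hmono i hi vQ C hC hCadm hCvol hneg (CandInternal11.hQShellOrbit_of_hull S P ρ qK hc hh)

/-- **RP-I06⋆ (`HQShellOrbitStar`, the labels of `𝔽_l^⋇` only) is false under a tight container.** [folklore] -/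
theorem hQShellOrbitStar_false_of_container (hq : QPinned S P ρ qK) (hmono : LogvolMono P)
    (i : Fin T.lstar) (hi : 1 ≤ (i : ℕ)) (vQ : T.VQ) (C : Set (S.L.Packet (Setting.labelSucc i) vQ))
    (hC : ∀ m : ℤ, ρ (shellSat S P.n ((S.col P.n).frobΨ m)) (Setting.labelSucc i) vQ ⊆ C)
    (hCadm : (S.D P.n).Adm _ vQ C)
    (hCvol : (S.D P.n).logvol _ vQ C ≤ (((i : ℕ) + 1 : ℕ) : ℝ) ^ 2 * P.qLocal (Setting.labelSucc i) vQ)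
    (hneg : P.qLocal (Setting.labelSucc i) vQ < 0) :
    ¬ CandInternal11Gap.HQShellOrbitStar S P ρ qK := fun hB => by
  have hsub : P.qRegion (Setting.labelSucc i) vQ ⊆ C := fun x hx => by
    rw [hq] at hx
    obtain ⟨m, hm⟩ := Set.mem_iUnion.1 (hB i vQ hx)
    exact hC m hm
  have h1 := hmono i vQ (P.hul_adm _ vQ _ (P.qRegion_mem _ vQ)) hCadm hsub
  exact not_le_jsq_mul_of_neg hneg hi (h1.trans hCvol)

/-- The gen-0 ceiling is the special case `C := the (Ind3)-Θ-region` (RP-I05b `HInd3Theta` + exact j²-scaling). [folklore] -/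
theorem hQShellOrbit_false_of_hInd3Theta (hq : QPinned S P ρ qK) (hA : HInd3Theta S P ρ) (hmono : LogvolMono P)
    (hθ : ∀ (j : T.Label) (vQ : T.VQ), (S.D P.n).Adm j vQ (P.thetaRegion3 j vQ))
    (i : Fin T.lstar) (hi : 1 ≤ (i : ℕ)) (vQ : T.VQ)
    (hscaled : (S.D P.n).logvol _ vQ (P.thetaRegion3 (Setting.labelSucc i) vQ) =
      (((i : ℕ) + 1 : ℕ) : ℝ) ^ 2 * P.qLocal (Setting.labelSucc i) vQ)
    (hneg : P.qLocal (Setting.labelSucc i) vQ < 0) :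
    ¬ HQShellOrbit S P ρ qK :=
  hQShellOrbit_false_of_container S P ρ qK hq hmono i hi vQ (P.thetaRegion3 _ vQ)
    (fun m => (hA m _ vQ).trans (Set.subset_iUnion (fun m : ℤ => P.thetaRegion m (Setting.labelSucc i) vQ) m)) (hθ _ vQ) hscaled.le hneg

end General

/-! ## 2. The instance K (abc-iut-w4-d101's coarse-frame coset bed): container `q^{j²}𝒪`, tight -/

section K

open Cor312.Checks Cor312.IdentifiedNonVacuity Cor312Vol.NaiveWitness Cor312Vol.PinnedWitness Cor312Vol.PinnedHonest
  Cor312Vol.UnitWitness Cor312Vol.UnitCoset Cor312Vol.UnitCosetCoarse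

variable (p : ℕ) [hp : Fact p.Prime]

/-- The container `q^{j²}𝒪` at the label `j = i+1` is admissible and has log-volume `−j²·log p = j²·qLocal`. [folklore] -/
theorem k_container (i : Fin Checks.toyIndex.lstar) (vQ : Checks.toyIndex.VQ) :
    (∀ m : ℤ, cosetRegion p (shellSat (kFull p).toLatticeSituation (kSetting p).n (((kFull p).toLatticeSituation.col (kSetting p).n).frobΨ m))
        (Setting.labelSucc i) vQ ⊆ uBall p (Setting.labelSucc i) vQ (jsq (Setting.labelSucc i))) ∧
      ((kFull p).toLatticeSituation.D (kSetting p).n).Adm _ vQ (uBall p (Setting.labelSucc i) vQ (jsq (Setting.labelSucc i))) ∧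
      ((kFull p).toLatticeSituation.D (kSetting p).n).logvol _ vQ (uBall p (Setting.labelSucc i) vQ (jsq (Setting.labelSucc i))) =
        (((i : ℕ) + 1 : ℕ) : ℝ) ^ 2 * (kSetting p).qLocal (Setting.labelSucc i) vQ := by
  refine ⟨fun m => cosetRegion_shellSat_subset p m (Setting.labelSucc_ne_zero i) vQ, (kLine_adm_iff p 0 _ vQ _).2 (Or.inl ⟨_, rfl⟩), ?_⟩
  show (kLine p 0).logvol _ vQ (uBall p _ vQ (jsq (Setting.labelSucc i))) = _
  rw [kLine_logvol, bvol_uBall, kSetting_qLocal]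
  unfold jsq Setting.labelSucc
  rw [Fin.val_succ]; push_cast; ring

/-- **RP-I06 ✗ at K by the container ceiling** (label `2`). [folklore] -/
theorem i06_false_k : ¬ HQShellOrbit (kFull p).toLatticeSituation (kSetting p) (cosetRegion p) (idealDatum p) := by
  obtain ⟨hC, hadm, hvol⟩ := k_container p ⟨1, by decide⟩ ()
  exact hQShellOrbit_false_of_container (kFull p).toLatticeSituation (kSetting p) (cosetRegion p) (idealDatum p)
    (kSetting_pinnedRegions3 p).1.2 (kSetting_bridgeHyps p).mono ⟨1, by decide⟩ le_rfl () _ hC hadm hvol.le (kSetting_qLocal_neg p _ ())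

/-- **RP-I06⋆ ✗ at K by the container ceiling** (= w4-d101's `i06star_not_at_kSetting`, re-derived). [folklore] -/
theorem i06star_false_k' :
    ¬ CandInternal11Gap.HQShellOrbitStar (kFull p).toLatticeSituation (kSetting p) (cosetRegion p) (idealDatum p) := by
  obtain ⟨hC, hadm, hvol⟩ := k_container p ⟨1, by decide⟩ ()
  exact hQShellOrbitStar_false_of_container (kFull p).toLatticeSituation (kSetting p) (cosetRegion p) (idealDatum p)
    (kSetting_pinnedRegions3 p).1.2 (kSetting_bridgeHyps p).mono ⟨1, by decide⟩ le_rfl () _ hC hadm hvol.le (kSetting_qLocal_neg p _ ())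

/-- **RP-I05c ✗ at K by the container ceiling** (= w4-d101's `i05c_not_at_kSetting`, re-derived; hull clause `kSetting_pilotKummerCompatHull`).
[folklore] -/
theorem i05c_false_k' : ¬ CandInternal11.H (kFull p).toLatticeSituation (kSetting p) (cosetRegion p) := by
  obtain ⟨hC, hadm, hvol⟩ := k_container p ⟨1, by decide⟩ ()
  exact i05c_false_of_container (kFull p).toLatticeSituation (kSetting p) (cosetRegion p) (idealDatum p)
    (kSetting_pinnedRegions3 p).1.2 (kSetting_bridgeHyps p).mono ⟨1, by decide⟩ le_rfl () _ hC hadm hvol.le (kSetting_qLocal_neg p _ ())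
    (kSetting_pilotKummerCompatHull p)

/-- **LIMIT #5 at K in one line**: the bed is SAT+ for the hull rows (Statement ✓, hull clause ✓, Step (x) ✓) yet every log-shell row fails,
because its log-shell container is tight (`= j²·qLocal`). [folklore] -/
theorem k_logShell_rows :
    (kSetting p).Statement ∧ PilotKummerCompatHull (kFull p).toLatticeSituation (kSetting p) (cosetRegion p) (idealDatum p) ∧
      ((kFull p).D (kSetting p).n).LogvolInvariant ∧
      ¬ HQShellOrbit (kFull p).toLatticeSituation (kSetting p) (cosetRegion p) (idealDatum p) ∧
      ¬ CandInternal11Gap.HQShellOrbitStar (kFull p).toLatticeSituation (kSetting p) (cosetRegion p) (idealDatum p) ∧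
      ¬ CandInternal11.H (kFull p).toLatticeSituation (kSetting p) (cosetRegion p) :=
  ⟨kSetting_statement p, kSetting_pilotKummerCompatHull p, kLine_logvolInvariant p 0, i06_false_k p, i06star_false_k' p, i05c_false_k' p⟩

end K

end Summit.ABC.IUTFork.Repair.EvalContainerCeiling

end
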